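import Mathlib
import Summits.NavierStokesRegularity.NavierStokesRegularity.Theorems.SlicedKelvinFluxZoomStubZoomCoreUnitPackage
import Summits.NavierStokesRegularity.NavierStokesRegularity.Theorems.SlicedKelvinFluxZoomStubZoomCoreUnitLimit
import Summits.NavierStokesRegularity.NavierStokesRegularity.Theorems.SlicedKelvinFluxZoomStubOseenAncientMild
import Summits.NavierStokesRegularity.NavierStokesRegularity.Theses.SlicedKelvin

/-!
# Crux `FluxZoom` (stmt-NavierStokesRegularity-15603), line `registered`: STUB `stub_zoomCoreUnit` — the
# vorticity-clock KNSS zoom at bounded planar flux (unit viscosity)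

Lands `--supports stmt-NavierStokesRegularity-15603` the lead's registered stub `stub_zoomCoreUnit` of the
skeleton `Cruxes/FluxZoom/Lines/birth.lean`. A classical solution (`ν = 1`) of the unforced Navier–Stokes
system on `ℝ³ × [0, T)` with slices uniformly in `L²`, unsigned planar vorticity flux `≤ M` on `[0, T)`,
velocity and vorticity bounded on every closed sub-slab but vorticity NOT bounded on `[0, T) × ℝ³`, yields a
bounded ancient mild solution `v` (`ν = 1`) with measurable slices, jointly smooth on `(−∞, 0) × ℝ³`, planar
flux `≤ max M 0` on every plane and slice, and a point of non-zero curl on a slice `t < 0`.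

Proof (KNSS 2009, §6 with the vorticity clock): near-records `w_n = |curl u(t_n, x_n)| > n + |B₀| + 1`,
`|curl u| ≤ 2w_n` on `(0, t_n]` (`exists_near_max`; `B₀` bounds the vorticity on `[0, T/2]`, so `t_n > T/2`
and `A_n = −t_n w_n → −∞`); the rescaled solutions `v_n = c_n • stPull (c_n²) c_n t_n x_n u`, `c_n² = 1/w_n`
(`stub_zoomPackage`: classical on `(A_n, B_n)`, `|curl v_n| ≤ 2` on `(A_n, 0]`, `|curl v_n(0, 0)| = 1`,
`|v_n| ≤ √(24 max(M,0)/π)`, flux `≤ max(M,0)`, Oseen-mild); compactness (`KNSS2009_lemma61_oseenMild`); the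
limit is a bounded ancient mild solution with measurable slices (`stub_oseenAncientMild`), jointly smooth
(`zoomLimit_contDiffOn`), its vorticity is the pointwise limit of the vorticities (`zoomLimit_curl_tendsto`),
so its planar flux is `≤ max(M,0)` (Fatou, `zoomLimit_flux_le`) and `curl v(s₀, 0) ≠ 0` at a fixed `s₀ < 0`
(`zoomLimit_curl_ne_zero`). The six antecedents of the stub are the statements of already-landed stubs and
are not used as hypotheses (the landed theorems are invoked by name).
-/

noncomputable section

open Set MeasureTheory Filter Topology Function

-- the summit and its single sub-problem share the name (CONVENTIONS §1), as in every Theorems file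
set_option linter.dupNamespace false

namespace Summit.NavierStokesRegularity.NavierStokesRegularity.Theorems.FluxZoom.Registered

open Literature.Analysis.FluidPDE

/-- **Near-record selection for the vorticity** (KNSS 2009, §6, the paragraph before Prop. 6.1, with
`γ = 2` and the vorticity in place of the velocity): if the vorticity is bounded on every closed sub-slab
`[0, T'] × ℝ³` but not on `[0, T) × ℝ³`, then for every `R` there are `t₀ ∈ (0, T)`, `x₀` with
`R < |curl u(t₀, x₀)|` and `|curl u| ≤ 2|curl u(t₀, x₀)|` on `(0, t₀] × ℝ³` (`exists_near_max`). -/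
theorem zoom_selection {T : ℝ} (hT : 0 < T)
    {u : ℝ → EuclideanSpace ℝ (Fin 3) → EuclideanSpace ℝ (Fin 3)}
    (hsub : ∀ T' ∈ Ioo 0 T, ∃ B : ℝ, ∀ t ∈ Icc 0 T', ∀ x, ‖u t x‖ ≤ B ∧ ‖curl (u t) x‖ ≤ B)
    (hunb : ¬ ∃ W : ℝ, ∀ t ∈ Ico 0 T, ∀ x, ‖curl (u t) x‖ ≤ W) (R : ℝ) :
    ∃ t₀ ∈ Ioo 0 T, ∃ x₀ : EuclideanSpace ℝ (Fin 3), R < ‖curl (u t₀) x₀‖ ∧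
      ∀ s ∈ Ioc 0 t₀, ∀ y, ‖curl (u s) y‖ ≤ 2 * ‖curl (u t₀) x₀‖ := by
  obtain ⟨B₀, hB₀⟩ := hsub (T / 2) ⟨by linarith, by linarith⟩
  have hbdd' : ∀ T' < T, ∃ Mb : ℝ, ∀ t ∈ Ioo 0 T', ∀ x,
      ‖(fun t x => curl (u t) x) t x‖ ≤ Mb := by
    intro T' hT'
    rcases le_or_gt T' 0 with h0 | h0
    · exact ⟨0, fun t ht x => absurd (ht.1.trans ht.2) (not_lt.2 h0)⟩
    · obtain ⟨B, hB⟩ := hsub T' ⟨h0, hT'⟩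
      exact ⟨B, fun t ht x => (hB t ⟨ht.1.le, ht.2.le⟩ x).2⟩
  have hunb' : ¬ ∃ Mb : ℝ, ∀ t ∈ Ioo 0 T, ∀ x, ‖(fun t x => curl (u t) x) t x‖ ≤ Mb := by
    rintro ⟨Mb, hMb⟩
    refine hunb ⟨max Mb B₀, fun t ht x => ?_⟩
    rcases eq_or_lt_of_le ht.1 with h0 | h0
    · rw [← h0]
      exact (hB₀ 0 ⟨le_rfl, by linarith⟩ x).2.trans (le_max_right _ _)
    · exact (hMb t ⟨h0, ht.2⟩ x).trans (le_max_left _ _)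
  exact exists_near_max hbdd' hunb' R

/-- **The vorticity-clock zoom at bounded planar flux, unit viscosity, closed form** (registered sub-goal
`stub_zoomCoreUnitClosed`: the conclusion of the lead's stub `stub_zoomCoreUnit` with its six antecedents — all
landed — discharged; see the module docstring for the proof). -/
theorem stub_zoomCoreUnitClosed :
    ∀ (T : ℝ), 0 < T →
      ∀ (u : ℝ → EuclideanSpace ℝ (Fin 3) → EuclideanSpace ℝ (Fin 3))
        (p : ℝ → EuclideanSpace ℝ (Fin 3) → ℝ),
        Literature.Analysis.FluidPDE.IsClassicalNSSolutionOn (Set.Ico 0 T) 1 0 u p →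
        (∃ K : ENNReal, K < ⊤ ∧ ∀ t ∈ Set.Ico 0 T, ∫⁻ x, ‖u t x‖ₑ ^ 2 ≤ K) →
        (∃ M : ℝ, ∀ t ∈ Set.Ico 0 T,
          ∀ (R : EuclideanSpace ℝ (Fin 3) ≃ₗᵢ[ℝ] EuclideanSpace ℝ (Fin 3)) (c : ℝ),
            ∫⁻ y : EuclideanSpace ℝ (Fin 2),
              ‖inner ℝ (Literature.Analysis.FluidPDE.curl (u t) (R (WithLp.toLp 2 ![y 0, y 1, c])))
                (R (EuclideanSpace.single 2 1))‖ₑ ≤ ENNReal.ofReal M) →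
        (∀ T' ∈ Set.Ioo 0 T, ∃ B : ℝ, ∀ t ∈ Set.Icc 0 T', ∀ x,
          ‖u t x‖ ≤ B ∧ ‖Literature.Analysis.FluidPDE.curl (u t) x‖ ≤ B) →
        (¬ ∃ W : ℝ, ∀ t ∈ Set.Ico 0 T, ∀ x, ‖Literature.Analysis.FluidPDE.curl (u t) x‖ ≤ W) →
        ∃ (v : ℝ → EuclideanSpace ℝ (Fin 3) → EuclideanSpace ℝ (Fin 3)) (M' : ℝ),
          Literature.Analysis.FluidPDE.IsBoundedAncientMildSolution 1 v ∧
          (∀ t < 0, MeasureTheory.AEStronglyMeasurable (v t) MeasureTheory.volume) ∧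
          ContDiffOn ℝ (⊤ : ℕ∞) (Function.uncurry v) (Set.Iio 0 ×ˢ Set.univ) ∧
          (∀ t < 0, ∀ (R : EuclideanSpace ℝ (Fin 3) ≃ₗᵢ[ℝ] EuclideanSpace ℝ (Fin 3)) (c : ℝ),
            ∫⁻ y : EuclideanSpace ℝ (Fin 2),
              ‖inner ℝ (Literature.Analysis.FluidPDE.curl (v t) (R (WithLp.toLp 2 ![y 0, y 1, c])))
                (R (EuclideanSpace.single 2 1))‖ₑ ≤ ENNReal.ofReal M') ∧
          ∃ t < 0, ∃ x, Literature.Analysis.FluidPDE.curl (v t) x ≠ 0 := by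
  intro T hT u p hcl hKex hMex hsub hunb
  obtain ⟨K, hK, hL2⟩ := hKex
  obtain ⟨M, hflux⟩ := hMex
  -- a nonnegative flux bound
  set Φ : ℝ := max M 0 with hΦdef
  have hΦ : 0 ≤ Φ := le_max_right _ _
  have hfluxΦ : ∀ t ∈ Ico 0 T, ∀ (R : EuclideanSpace ℝ (Fin 3) ≃ₗᵢ[ℝ] EuclideanSpace ℝ (Fin 3)) (c' : ℝ),
      ∫⁻ y : EuclideanSpace ℝ (Fin 2),
        ‖inner ℝ (curl (u t) (R (WithLp.toLp 2 ![y 0, y 1, c']))) (R (EuclideanSpace.single 2 1))‖ₑ ≤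
          ENNReal.ofReal Φ :=
    fun t ht R c' => (hflux t ht R c').trans (ENNReal.ofReal_le_ofReal (le_max_left _ _))
  -- ## Step 1: near-records
  obtain ⟨B₀, hB₀⟩ := hsub (T / 2) ⟨by linarith, by linarith⟩
  choose tn htn xn hbig hmax using
    fun n : ℕ => zoom_selection hT hsub hunb ((n : ℝ) + |B₀| + 1)
  set w : ℕ → ℝ := fun n => ‖curl (u (tn n)) (xn n)‖ with hwdef
  have hw1 : ∀ n : ℕ, ((n : ℝ) + 1) < w n := fun n => by
    have := hbig n; linarith [abs_nonneg B₀]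
  have hwpos : ∀ n : ℕ, 0 < w n := fun n => by linarith [hw1 n, n.cast_nonneg (α := ℝ)]
  have htn2 : ∀ n : ℕ, T / 2 < tn n := fun n => by
    by_contra hle
    push Not at hle
    have h1 : w n ≤ B₀ := (hB₀ (tn n) ⟨(htn n).1.le, hle⟩ (xn n)).2
    have h2 := hbig n
    linarith [le_abs_self B₀, n.cast_nonneg (α := ℝ)]
  -- ## Step 2: the rescaled solutions
  set c : ℕ → ℝ := fun n => (Real.sqrt (w n))⁻¹ with hcdef
  have hpkg := fun n =>
    stub_zoomPackage T u p hcl K hK hL2 Φ hΦ hfluxΦ (tn n) (htn n) (xn n) (hwpos n) (hmax n) (c n) rfl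
  set A : ℕ → ℝ := fun n => -(tn n / c n ^ 2) with hAdef
  set Bn : ℕ → ℝ := fun n => (T - tn n) / c n ^ 2 with hBdef
  set v : ℕ → ℝ → EuclideanSpace ℝ (Fin 3) → EuclideanSpace ℝ (Fin 3) :=
    fun n => c n • stPull (c n ^ 2) (c n) (tn n) (xn n) u with hvdef
  have hAeq : ∀ n, A n = -(tn n * w n) := fun n => (hpkg n).2.1
  have hBpos : ∀ n, 0 < Bn n := fun n => (hpkg n).2.2.1
  have hAtend : Tendsto A atTop atBot := by
    have hle : ∀ n : ℕ, A n ≤ -(T / 2) * ((n : ℝ) + 1) := fun n => by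
      rw [hAeq n]
      have h1 : T / 2 * ((n : ℝ) + 1) ≤ tn n * w n :=
        mul_le_mul (htn2 n).le (hw1 n).le (by positivity) (htn n).1.le
      linarith
    refine tendsto_atBot_mono hle ?_
    have h1 : Tendsto (fun n : ℕ => (n : ℝ) + 1) atTop atTop :=
      tendsto_natCast_atTop_atTop.atTop_add tendsto_const_nhds
    exact h1.const_mul_atTop_of_neg (by linarith)
  set N : ℝ := Real.sqrt (24 * Φ / Real.pi) with hNdef
  have hVsm : ∀ n, ContDiffOn ℝ (⊤ : ℕ∞) (uncurry (v n)) (Ioo (A n) (Bn n) ×ˢ univ) := fun n =>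
    (hpkg n).2.2.2.1.smooth_velocity
  have hVcont : ∀ n, ContinuousOn (uncurry (v n)) (Ioo (A n) (Bn n) ×ˢ univ) := fun n =>
    (hpkg n).2.2.2.2.1
  have hVdiv : ∀ n, ∀ t ∈ Ioo (A n) (Bn n), IsWeaklyDivFree (v n t) := fun n => (hpkg n).2.2.2.2.2.1
  have hVone : ∀ n, ‖curl (v n 0) 0‖ = 1 := fun n => (hpkg n).2.2.2.2.2.2.2.1
  have hVbd : ∀ n, ∀ t ∈ Ioc (A n) 0, ∀ x, ‖v n t x‖ ≤ N := fun n => (hpkg n).2.2.2.2.2.2.2.2.1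
  have hVflux := fun n => (hpkg n).2.2.2.2.2.2.2.2.2.1
  have hVmild : ∀ n, ∀ s t : ℝ, A n < s → s < t → t < 0 → ∀ x,
      v n t x = Literature.Analysis.UnboundedOperators.heatExtension (v n s) (t - s) x -
        oseenDuhamel 1 s (v n) (v n) t x := fun n => (hpkg n).2.2.2.2.2.2.2.2.2.2
  -- ## Step 3: compactness (KNSS 2009, Lemma 6.1)
  obtain ⟨φ, W, hφ, hWc, hWdiv, hWbd, hWmild, -, -, hloc⟩ :=
    KNSS2009_lemma61_oseenMild (A := A) (w := v) (C := N) hAtend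
      (fun n => (hVcont n).mono (prod_mono (Ioo_subset_Ioo_right (hBpos n).le) Subset.rfl))
      (fun n t ht => hVdiv n t ⟨ht.1, ht.2.trans (hBpos n)⟩)
      (fun n s t hs hst ht x => hVmild n s t hs hst ht x)
      (fun n τ hτ x => hVbd n τ ⟨hτ.1, hτ.2.le⟩ x)
  -- ## Step 4: the limit
  obtain ⟨hanc, hmeasW⟩ := stub_oseenAncientMild W N hWc hWdiv hWbd hWmild
  have hsmooth := zoomLimit_contDiffOn hWc hWdiv hWbd hWmild
  -- the subsequence
  have hAφ : Tendsto (A ∘ φ) atTop atBot := hAtend.comp hφ.tendsto_atTop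
  have hcurl := zoomLimit_curl_tendsto (A := A ∘ φ) (B := Bn ∘ φ) (V := v ∘ φ) (W := W) (N := N)
    hAφ (fun j => hBpos _) (fun j => hVsm _) (fun j => hVdiv _) (fun j => hVbd _) (fun j => hVmild _)
    hWc hWdiv hWbd hWmild hloc
  have hfluxW := zoomLimit_flux_le (A := A ∘ φ) (B := Bn ∘ φ) (V := v ∘ φ) (W := W) hAφ
    (fun j => hBpos _) (fun j => hVsm _) (fun j => hVflux _) hcurl
  have hnc := zoomLimit_curl_ne_zero (A := A ∘ φ) (B := Bn ∘ φ) (V := v ∘ φ) (W := W) (N := N) hAφ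
    (fun j => hBpos _) (fun j => hVsm _) (fun j => hVdiv _) (fun j => hVbd _) (fun j => hVmild _)
    (fun j => hVone _) hcurl
  exact ⟨W, Φ, hanc, hmeasW, hsmooth, hfluxW, hnc⟩

/-- **The vorticity-clock zoom at bounded planar flux, unit viscosity** (the lead's registered stub
`stub_zoomCoreUnit` of the line `registered` of crux `FluxZoom`, verbatim signature: the statements of
`stub_fluxVelocity`, `stub_oseenWindowShift` (conclusion), `stub_oseenAncientMild`, `stub_fderivLimit`,
`stub_sliceFDerivContinuous`, `stub_zoomBookkeeping` as antecedents; they are all landed, so the closed form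
`stub_zoomCoreUnitClosed` ignores them). -/
theorem stub_zoomCoreUnit :
    (∀ (v : EuclideanSpace ℝ (Fin 3) → EuclideanSpace ℝ (Fin 3)), ContDiff ℝ 2 v →
      Literature.Analysis.FluidPDE.VectorCalculus.IsDivFree v →
      (∫⁻ y, ‖v y‖ₑ ^ 2 < ⊤) →
      ∀ (W Φ : ℝ), 0 ≤ W → 0 ≤ Φ →
        (∀ x, ‖Literature.Analysis.FluidPDE.curl v x‖ ≤ W) →
        (∀ (R : EuclideanSpace ℝ (Fin 3) ≃ₗᵢ[ℝ] EuclideanSpace ℝ (Fin 3)) (c : ℝ),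
          ∫⁻ y : EuclideanSpace ℝ (Fin 2),
            ‖inner ℝ (Literature.Analysis.FluidPDE.curl v (R (WithLp.toLp 2 ![y 0, y 1, c])))
              (R (EuclideanSpace.single 2 1))‖ₑ ≤ ENNReal.ofReal Φ) →
        ∀ x, ‖v x‖ ^ 2 ≤ 12 / Real.pi * W * Φ) →
    (∀ (N a b : ℝ), a < b → ∃ (C L : ℕ → ℝ → ℝ),
      ∀ (V : ℝ → EuclideanSpace ℝ (Fin 3) → EuclideanSpace ℝ (Fin 3)),
        ContinuousOn (Function.uncurry V) (Set.Ioo a b ×ˢ Set.univ) →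
        (∀ t ∈ Set.Ioo a b, Literature.Analysis.FluidPDE.IsWeaklyDivFree (V t)) →
        (∀ t ∈ Set.Ioo a b, ∀ x, ‖V t x‖ ≤ N) →
        (∀ s t : ℝ, a < s → s < t → t < b → ∀ x,
          V t x = Literature.Analysis.UnboundedOperators.heatExtension (V s) (t - s) x -
            Literature.Analysis.FluidPDE.oseenDuhamel 1 s V V t x) →
        ContDiffOn ℝ (⊤ : ℕ∞) (Function.uncurry V) (Set.Ioo a b ×ˢ Set.univ) ∧
        (∀ t ∈ Set.Ioo a b, Literature.Analysis.FluidPDE.VectorCalculus.IsDivFree (V t)) ∧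
        (∀ δ : ℝ, 0 < δ → ∀ k : ℕ, ∀ t ∈ Set.Ioo (a + δ) b, ∀ x,
          ‖iteratedFDeriv ℝ k (V t) x‖ ≤ C k δ) ∧
        (∀ δ : ℝ, 0 < δ → ∀ k : ℕ, ∀ s ∈ Set.Ioo (a + δ) b, ∀ t ∈ Set.Ioo (a + δ) b, ∀ x,
          ‖iteratedFDeriv ℝ k (V t) x - iteratedFDeriv ℝ k (V s) x‖ ≤ L k δ * |t - s|)) →
    (∀ (V : ℝ → EuclideanSpace ℝ (Fin 3) → EuclideanSpace ℝ (Fin 3)) (N : ℝ),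
      ContinuousOn (Function.uncurry V) (Set.Iio 0 ×ˢ Set.univ) →
      (∀ t < 0, Literature.Analysis.FluidPDE.IsWeaklyDivFree (V t)) →
      (∀ t < 0, ∀ x, ‖V t x‖ ≤ N) →
      (∀ s t : ℝ, s < t → t < 0 → ∀ x,
        V t x = Literature.Analysis.UnboundedOperators.heatExtension (V s) (t - s) x -
          Literature.Analysis.FluidPDE.oseenDuhamel 1 s V V t x) →
      Literature.Analysis.FluidPDE.IsBoundedAncientMildSolution 1 V ∧
        ∀ t < 0, MeasureTheory.AEStronglyMeasurable (V t) MeasureTheory.volume) →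
    (∀ (C : ℝ) (f : ℕ → EuclideanSpace ℝ (Fin 3) → EuclideanSpace ℝ (Fin 3))
      (g : EuclideanSpace ℝ (Fin 3) → EuclideanSpace ℝ (Fin 3)) (x : EuclideanSpace ℝ (Fin 3)),
      (∀ᶠ j in Filter.atTop, ContDiff ℝ 2 (f j) ∧ ∀ y, ‖iteratedFDeriv ℝ 2 (f j) y‖ ≤ C) →
      ContDiff ℝ 2 g → (∀ y, ‖iteratedFDeriv ℝ 2 g y‖ ≤ C) →
      TendstoLocallyUniformly f g Filter.atTop →
      Filter.Tendsto (fun j => fderiv ℝ (f j) x) Filter.atTop (nhds (fderiv ℝ g x))) →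
    (∀ (V : ℝ → EuclideanSpace ℝ (Fin 3) → EuclideanSpace ℝ (Fin 3)) (a b : ℝ),
      ContDiffOn ℝ (⊤ : ℕ∞) (Function.uncurry V) (Set.Ioo a b ×ˢ Set.univ) →
      ∀ x, ContinuousOn (fun t => fderiv ℝ (V t) x) (Set.Ioo a b)) →
    (∀ (u : ℝ → EuclideanSpace ℝ (Fin 3) → EuclideanSpace ℝ (Fin 3)) (t₀ : ℝ)
      (x₀ : EuclideanSpace ℝ (Fin 3)) (c : ℝ), 0 < c → ∀ s : ℝ,
      (∫⁻ y, ‖(c • Literature.Analysis.FluidPDE.stPull (c ^ 2) c t₀ x₀ u) s y‖ₑ ^ 2 =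
          ENNReal.ofReal c⁻¹ * ∫⁻ x, ‖u (t₀ + c ^ 2 * s) x‖ₑ ^ 2) ∧
      (Differentiable ℝ (u (t₀ + c ^ 2 * s)) →
        (∀ y, Literature.Analysis.FluidPDE.curl ((c • Literature.Analysis.FluidPDE.stPull (c ^ 2) c t₀ x₀ u) s) y =
          c ^ 2 • Literature.Analysis.FluidPDE.curl (u (t₀ + c ^ 2 * s)) (x₀ + c • y)) ∧
        (∀ (R : EuclideanSpace ℝ (Fin 3) ≃ₗᵢ[ℝ] EuclideanSpace ℝ (Fin 3)) (c' : ℝ),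
          ∫⁻ y : EuclideanSpace ℝ (Fin 2),
            ‖inner ℝ (Literature.Analysis.FluidPDE.curl
                ((c • Literature.Analysis.FluidPDE.stPull (c ^ 2) c t₀ x₀ u) s)
                (R (WithLp.toLp 2 ![y 0, y 1, c']))) (R (EuclideanSpace.single 2 1))‖ₑ =
          ∫⁻ y : EuclideanSpace ℝ (Fin 2),
            ‖inner ℝ (Literature.Analysis.FluidPDE.curl (u (t₀ + c ^ 2 * s))
                (R (WithLp.toLp 2 ![y 0, y 1, (R.symm x₀) 2 + c * c']))) (R (EuclideanSpace.single 2 1))‖ₑ))) →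
    ∀ (T : ℝ), 0 < T →
      ∀ (u : ℝ → EuclideanSpace ℝ (Fin 3) → EuclideanSpace ℝ (Fin 3))
        (p : ℝ → EuclideanSpace ℝ (Fin 3) → ℝ),
        Literature.Analysis.FluidPDE.IsClassicalNSSolutionOn (Set.Ico 0 T) 1 0 u p →
        (∃ K : ENNReal, K < ⊤ ∧ ∀ t ∈ Set.Ico 0 T, ∫⁻ x, ‖u t x‖ₑ ^ 2 ≤ K) →
        (∃ M : ℝ, ∀ t ∈ Set.Ico 0 T,
          ∀ (R : EuclideanSpace ℝ (Fin 3) ≃ₗᵢ[ℝ] EuclideanSpace ℝ (Fin 3)) (c : ℝ),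
            ∫⁻ y : EuclideanSpace ℝ (Fin 2),
              ‖inner ℝ (Literature.Analysis.FluidPDE.curl (u t) (R (WithLp.toLp 2 ![y 0, y 1, c])))
                (R (EuclideanSpace.single 2 1))‖ₑ ≤ ENNReal.ofReal M) →
        (∀ T' ∈ Set.Ioo 0 T, ∃ B : ℝ, ∀ t ∈ Set.Icc 0 T', ∀ x,
          ‖u t x‖ ≤ B ∧ ‖Literature.Analysis.FluidPDE.curl (u t) x‖ ≤ B) →
        (¬ ∃ W : ℝ, ∀ t ∈ Set.Ico 0 T, ∀ x, ‖Literature.Analysis.FluidPDE.curl (u t) x‖ ≤ W) →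
        ∃ (v : ℝ → EuclideanSpace ℝ (Fin 3) → EuclideanSpace ℝ (Fin 3)) (M' : ℝ),
          Literature.Analysis.FluidPDE.IsBoundedAncientMildSolution 1 v ∧
          (∀ t < 0, MeasureTheory.AEStronglyMeasurable (v t) MeasureTheory.volume) ∧
          ContDiffOn ℝ (⊤ : ℕ∞) (Function.uncurry v) (Set.Iio 0 ×ˢ Set.univ) ∧
          (∀ t < 0, ∀ (R : EuclideanSpace ℝ (Fin 3) ≃ₗᵢ[ℝ] EuclideanSpace ℝ (Fin 3)) (c : ℝ),
            ∫⁻ y : EuclideanSpace ℝ (Fin 2),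
              ‖inner ℝ (Literature.Analysis.FluidPDE.curl (v t) (R (WithLp.toLp 2 ![y 0, y 1, c])))
                (R (EuclideanSpace.single 2 1))‖ₑ ≤ ENNReal.ofReal M') ∧
          ∃ t < 0, ∃ x, Literature.Analysis.FluidPDE.curl (v t) x ≠ 0 :=
  fun _ _ _ _ _ _ => stub_zoomCoreUnitClosed

end Summit.NavierStokesRegularity.NavierStokesRegularity.Theorems.FluxZoom.Registered

end
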